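import Mathlib.Algebra.MvPolynomial.PDeriv
import Mathlib.RingTheory.MvPolynomial.Ideal
import Mathlib.RingTheory.Ideal.Quotient.Operations
import Literature.AlgebraicGeometry.Resolution.StrictlyStandardSmooth
import Literature.AlgebraicGeometry.Resolution.NeronPopescuLocalTricks
import HarnessLib

/-!
# The desingularization lemma (Stacks 07CR), I: the algebra `B` and the case `π ∉ 𝔮`

Topic: `Literature/AlgebraicGeometry/Resolution`. The Stacks Project, *Smoothing Ring Maps*
(Tag 07BW), Lemma 07CR (= Lemma 16.7.1, "another fiendishly clever lemma"):

> **Lemma 07CR.** Let `R` be a Noetherian ring. Let `Λ` be an `R`-algebra. Let `π ∈ R` and assume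
> that `Ann_Λ(π) = Ann_Λ(π²)`. Let `A → Λ` be an `R`-algebra map with `A` of finite presentation.
> Assume (1) the image of `π` is strictly standard in `A` over `R`, and (2) there exists a
> section `ρ : A/π⁴A → R/π⁴R` which is compatible with the map to `Λ/π⁴Λ`. Then we can find
> `R`-algebra maps `A → B → Λ` with `B` of finite presentation such that `𝔞B ⊂ H_{B/R}` where
> `𝔞 = Ann_R(Ann_R(π²)/Ann_R(π))`.

This file formalizes the CONSTRUCTION in the printed proof and its first properties, for given
numerical data (a presentation `A = R[x_1, …, x_n]/(f_1, …, f_m)` and `c ≤ m`, the centre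
`r ∈ R^n` with `ρ(x_i) = r_i mod π⁴`, constants `f_j(r) = π⁴ t_j`, the matrix
`r_{ji} = (∂f_j/∂x_i)(r)` and an `n × c` matrix `(s_{ik})` with `∑_i r_{ji} s_{ik} = uπ δ_{jk}`,
`u = 1 - π³ t₀`), namely — following Stacks except that the variables `x_i` are eliminated at
once using `h_i = x_i - π² ∑ s_{ij} v_j - π³ w_i` —

* the substitution `x_i ↦ r_i + π² ∑_k s_{ik} v_k + π³ w_i` (`subst`) and the identity
  `f_j(x(v, w)) = f_j(r) + ∑_i (∂_i f_j)(r) δx_i + π⁴ q_j` (`exists_subst_eq`, Taylor expansion to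
  first order, `sub_linear_mem_sq`);
* Stacks' `g_j ∈ R[v, w]`, `j ≤ c`, with `f_j(x(v, w)) = π³ g_j` and
  `g_j ≡ v_j + ∑_i r_{ji} w_i mod π` (`gPoly`, `C_mul_gPoly`, `gPoly_sub_mem`), and for `j > c` the
  divisibility `f_j(x(v, w)) ∈ (π²)` (`exists_subst_eq_C_sq_mul`);
* the algebra `B = R[v, w]/(g_1, …, g_c, f̃_{c+1}, …, f̃_m)` (`Balg`; of finite presentation), the
  maps `A → B` (`toB`) and `B → Λ` (`toΛ`, `v ↦ 0`, `w_i ↦ πλ_i` where `φ(x_i) = r_i + π⁴λ_i`; the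
  relations die by "`g_i` is mapped to an element `t` of `πΛ` such that `π³t = 0` … hence
  `t = 0`", `evΛ_relB`) with `A → B → Λ = φ` (`toΛ_toB`);
* the case `π ∉ 𝔮`: "`B_π ≅ A_π[v_1, …, v_c]` … Hence `B_π` is smooth over `R` as `A_π` is smooth
  over `R`" — here `B_π` is exhibited as a retract of `A_π[v]` (`ΘBπ_comp_ΞBπ`), so that `B_π` is
  formally smooth over `R` as soon as `A_π` is (`formallySmooth_Bπ`; `A_π` is smooth by Elkik's
  Lemma 07CA, `IsStrictlyStandard.smooth`, `StrictlyStandardSmooth.lean`).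

The remaining case `π ∈ 𝔮, 𝔞 ⊄ 𝔮` (the ring `B' = R[v, w]/(g)`, its smoothness at `V(π)` — which
we shall obtain from the Jacobian `det(∂g_j/∂v_k) ≡ 1 mod π` rather than from the fibrewise
criterion quoted by Stacks — Nakayama and the flatness argument) and the derivation of the
numerical data from hypotheses (1), (2) are in part II.

## References

* The Stacks Project, *Smoothing Ring Maps* (Tag 07BW), Lemma 07CR and its proof.
  [StacksProject]
-/

noncomputable section

open MvPolynomial

namespace Literature.AlgebraicGeometry.Resolution

namespace Stacks07CR

universe u

/-! ## ST1. Polynomial preliminaries: Taylor shift, constant and linear terms -/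

section Poly

variable {R : Type u} [CommRing R] {σ : Type} [Fintype σ] [DecidableEq σ]

/-- The translation `f(x) ↦ f(x + r)`. [folklore] -/
abbrev shift (r : σ → R) : MvPolynomial σ R →ₐ[R] MvPolynomial σ R :=
  aeval fun i => X i + C (r i)

omit [Fintype σ] [DecidableEq σ] in
/-- `shift r (X i) = X i + r i`. [folklore] -/
theorem shift_X (r : σ → R) (i : σ) : shift r (X i) = X i + C (r i) := aeval_X _ i

omit [Fintype σ] in
/-- Chain rule for a translation: `∂_i (f(x + r)) = (∂_i f)(x + r)`. [folklore] -/
theorem pderiv_shift (r : σ → R) (i : σ) (f : MvPolynomial σ R) :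
    pderiv i (shift r f) = shift r (pderiv i f) := by
  induction f using MvPolynomial.induction_on with
  | C a => simp only [aeval_C, algebraMap_eq, pderiv_C, map_zero]
  | add p q hp hq => rw [map_add, map_add, map_add, map_add, hp, hq]
  | mul_X p k hp =>
    simp only [map_mul, shift_X, Derivation.leibniz, smul_eq_mul, map_add, hp, pderiv_C, add_zero,
      pderiv_X, Pi.single_apply]
    split_ifs <;> simp

omit [Fintype σ] [DecidableEq σ] in
/-- The constant term of `f(x + r)` is `f(r)`. [folklore] -/
theorem constantCoeff_shift (r : σ → R) (f : MvPolynomial σ R) :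
    constantCoeff (shift r f) = aeval r f := by
  have h : (aeval (0 : σ → R)).comp (shift r) = aeval r := by
    rw [MvPolynomial.comp_aeval]
    congr 1
    funext i
    simp
  have := AlgHom.congr_fun h f
  rw [AlgHom.comp_apply, aeval_zero, Algebra.algebraMap_self, RingHom.id_apply] at this
  exact this

omit [Fintype σ] in
/-- The coefficient of `x_i` is the constant term of `∂f/∂x_i`. [folklore] -/
theorem constantCoeff_pderiv (i : σ) (f : MvPolynomial σ R) :
    constantCoeff (pderiv i f) = coeff (Finsupp.single i 1) f := by
  induction f using MvPolynomial.induction_on' with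
  | monomial α a =>
    rw [pderiv_monomial, constantCoeff_monomial, coeff_monomial]
    by_cases hα : α = Finsupp.single i 1
    · subst hα
      simp
    · rw [if_neg hα]
      split_ifs with h
      · -- `α - e_i = 0` but `α ≠ e_i`, so `α i = 0`
        have hle : α ≤ Finsupp.single i 1 := tsub_eq_zero_iff_le.mp h
        have hαi : α i = 0 := by
          have h1 : α i ≤ 1 := by simpa using hle i
          rcases Nat.le_one_iff_eq_zero_or_eq_one.mp h1 with h0 | h1'
          · exact h0
          · exfalso
            apply hα
            ext j
            by_cases hji : j = i
            · subst hji; simp [h1']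
            · have := hle j
              simp [Ne.symm hji] at this
              simp [Ne.symm hji, this]
        simp [hαi]
      · rfl
  | add p q hp hq => rw [map_add, map_add, coeff_add, hp, hq]

omit [Fintype σ] [DecidableEq σ] in
/-- A polynomial without constant and linear terms lies in `(x_1, …, x_n)²`. [folklore] -/
theorem mem_sq_span_X_of_coeff (p : MvPolynomial σ R) (h0 : coeff 0 p = 0)
    (h1 : ∀ k, coeff (Finsupp.single k 1) p = 0) :
    p ∈ (Ideal.span (Set.range (X : σ → MvPolynomial σ R))) ^ 2 := by
  classical
  rw [p.as_sum]
  refine Ideal.sum_mem _ fun α hα => ?_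
  have hα0 : α ≠ 0 := by
    rintro rfl
    exact (mem_support_iff.mp hα) h0
  obtain ⟨k, hk⟩ := Finsupp.ne_iff.mp hα0
  simp only [Finsupp.coe_zero, Pi.zero_apply] at hk
  have hk1 : Finsupp.single k 1 ≤ α := by
    refine Finsupp.single_le_iff.mpr ?_
    omega
  set β := α - Finsupp.single k 1 with hβ
  have hαβ : α = β + Finsupp.single k 1 := (tsub_add_cancel_of_le hk1).symm
  have hβ0 : β ≠ 0 := by
    intro hb
    apply (mem_support_iff.mp hα)
    rw [hαβ, hb, zero_add]
    exact h1 k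
  obtain ⟨l, hl⟩ := Finsupp.ne_iff.mp hβ0
  simp only [Finsupp.coe_zero, Pi.zero_apply] at hl
  have hl1 : Finsupp.single l 1 ≤ β := by
    refine Finsupp.single_le_iff.mpr ?_
    omega
  set γ := β - Finsupp.single l 1 with hγ
  have hβγ : β = γ + Finsupp.single l 1 := (tsub_add_cancel_of_le hl1).symm
  have hmon : monomial α (coeff α p) = X k * (X l * monomial γ (coeff α p)) := by
    rw [show α = Finsupp.single k 1 + (Finsupp.single l 1 + γ) by
      rw [hαβ, hβγ, add_comm (γ + _), add_comm γ], monomial_single_add, monomial_single_add,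
      pow_one, pow_one]
  rw [hmon, pow_two]
  refine Ideal.mul_mem_mul (Ideal.subset_span ⟨k, rfl⟩) ?_
  exact Ideal.mul_mem_right _ _ (Ideal.subset_span ⟨l, rfl⟩)

/-- **Taylor expansion to first order**: `f - f(0) - ∑_i (∂f/∂x_i)(0) x_i ∈ (x_1, …, x_n)²`.
[folklore] -/
theorem sub_linear_mem_sq (f : MvPolynomial σ R) :
    f - C (constantCoeff f) - ∑ i, C (constantCoeff (pderiv i f)) * X i ∈
      (Ideal.span (Set.range (X : σ → MvPolynomial σ R))) ^ 2 := by
  refine mem_sq_span_X_of_coeff _ ?_ fun k => ?_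
  · have hc : ∀ i : σ, coeff (0 : σ →₀ ℕ) (C (constantCoeff (pderiv i f)) * X i) = 0 :=
      fun i => by rw [coeff_C_mul, coeff_zero_X, mul_zero]
    rw [coeff_sub, coeff_sub, coeff_sum, Finset.sum_eq_zero (fun i _ => hc i), sub_zero,
      coeff_zero_C]
    exact sub_self _
  · have hne : (0 : σ →₀ ℕ) ≠ Finsupp.single k 1 := (Finsupp.single_ne_zero.mpr one_ne_zero).symm
    rw [coeff_sub, coeff_sub, coeff_sum, coeff_C, if_neg hne, sub_zero]
    simp [coeff_C_mul, coeff_X, Finsupp.single_left_inj, constantCoeff_pderiv]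

omit [Fintype σ] [DecidableEq σ] in
/-- `S₀(x_i) ∈ (π²)` for all `i` implies `S₀((x)²) ⊆ (π⁴)`. [folklore] -/
theorem map_sq_span_X_le {τ : Type} (g : σ → MvPolynomial τ R) (π : R)
    (hg : ∀ i, g i ∈ Ideal.span {(C (π ^ 2) : MvPolynomial τ R)}) :
    Ideal.map (aeval g : MvPolynomial σ R →ₐ[R] MvPolynomial τ R)
      ((Ideal.span (Set.range (X : σ → MvPolynomial σ R))) ^ 2) ≤
      Ideal.span {(C (π ^ 4) : MvPolynomial τ R)} := by
  rw [Ideal.map_pow, Ideal.map_span, show π ^ 4 = π ^ 2 * π ^ 2 by ring, map_mul,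
    ← Ideal.span_singleton_mul_span_singleton, ← pow_two]
  refine Ideal.pow_right_mono ?_ 2
  rw [Ideal.span_le]
  rintro _ ⟨_, ⟨i, rfl⟩, rfl⟩
  simpa using hg i

end Poly

/-! ## ST2–ST3. The substitution `x_i = r_i + π² ∑_k s_{ik} v_k + π³ w_i` and the `g_j` -/

section Subst

variable {R : Type u} [CommRing R] {n c : ℕ}

/-- Variables `v_1, …, v_c, w_1, …, w_n`. [folklore] -/
abbrev V (c n : ℕ) := Fin c ⊕ Fin n

variable (π : R) (r : Fin n → R) (Bm : Matrix (Fin c) (Fin n) R)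

/-- `e_i = ∑_k s_{ik} v_k + π w_i`. [cite: StacksProject, Tag 07CR] -/
def eV (i : Fin n) : MvPolynomial (V c n) R :=
  ∑ k, C (Bm k i) * X (Sum.inl k) + C π * X (Sum.inr i)

/-- `δx_i = π² e_i = π² ∑_k s_{ik} v_k + π³ w_i` (so that `x_i = r_i + δx_i`, i.e. Stacks'
`h_i = x_i - π² ∑ s_{ij} v_j - π³ w_i`). [cite: StacksProject, Tag 07CR] -/
def δx (i : Fin n) : MvPolynomial (V c n) R := C (π ^ 2) * eV π Bm i

/-- The substitution `x_i ↦ r_i + π² ∑_k s_{ik} v_k + π³ w_i`. [cite: StacksProject, Tag 07CR] -/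
abbrev subst : MvPolynomial (Fin n) R →ₐ[R] MvPolynomial (V c n) R :=
  aeval fun i => C (r i) + δx π Bm i

/-- The homogeneous part of the substitution, `x_i ↦ δx_i`. [cite: StacksProject, Tag 07CR] -/
abbrev subst₀ : MvPolynomial (Fin n) R →ₐ[R] MvPolynomial (V c n) R :=
  aeval (δx π Bm)

/-- `x(v,w) = r + δx`: the substitution is the Taylor shift followed by `x ↦ δx`. [folklore] -/
theorem subst_eq_subst₀_comp_shift : subst π r Bm = (subst₀ π Bm).comp (shift r) := by
  refine MvPolynomial.algHom_ext fun i => ?_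
  rw [AlgHom.comp_apply, shift_X, map_add, aeval_X, aeval_C, algebraMap_eq, aeval_X, add_comm]

/-- `δx_i ∈ (π²)`. [folklore] -/
theorem δx_mem (i : Fin n) : δx π Bm i ∈ Ideal.span {(C (π ^ 2) : MvPolynomial (V c n) R)} :=
  Ideal.mem_span_singleton'.mpr ⟨eV π Bm i, by rw [δx, mul_comm]⟩

/-- The image of `f` under the substitution is `f(r) + ∑_i (∂_i f)(r) δx_i` up to `(π⁴)`.
[cite: StacksProject, Tag 07CR] -/
theorem exists_subst_eq (f : MvPolynomial (Fin n) R) :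
    ∃ q : MvPolynomial (V c n) R, subst π r Bm f =
      C (aeval r f) + ∑ i, C (aeval r (pderiv i f)) * δx π Bm i + C (π ^ 4) * q := by
  have hmem := map_sq_span_X_le (δx π Bm) π (δx_mem π Bm)
    (Ideal.mem_map_of_mem _ (sub_linear_mem_sq (shift r f)))
  obtain ⟨q, hq⟩ := Ideal.mem_span_singleton'.mp hmem
  refine ⟨q, ?_⟩
  rw [subst_eq_subst₀_comp_shift, AlgHom.comp_apply]
  have : subst₀ π Bm (shift r f) = subst₀ π Bm (C (constantCoeff (shift r f)) +
      ∑ i, C (constantCoeff (pderiv i (shift r f))) * X i) +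
      subst₀ π Bm (shift r f - C (constantCoeff (shift r f)) -
        ∑ i, C (constantCoeff (pderiv i (shift r f))) * X i) := by
    rw [← map_add]; congr 1; ring
  rw [this, ← hq, map_add, map_sum, aeval_C, algebraMap_eq, constantCoeff_shift, mul_comm q]
  congr 2
  refine Finset.sum_congr rfl fun i _ => ?_
  rw [map_mul, aeval_C, algebraMap_eq, aeval_X, pderiv_shift, constantCoeff_shift]

/-- `δx_i = ∑_k π² s_{ik} v_k + π³ w_i`. [cite: StacksProject, Tag 07CR] -/
theorem δx_eq (i : Fin n) :
    δx π Bm i = (∑ k, C (π ^ 2 * Bm k i) * X (Sum.inl k)) + C (π ^ 3) * X (Sum.inr i) := by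
  rw [δx, eV, mul_add, Finset.mul_sum]
  simp_rw [← mul_assoc, ← map_mul]
  rw [show π ^ 2 * π = π ^ 3 by ring]

/-- **The linear terms** (Stacks 07CR: "`f_j = … = π² ∑_k (∑_i r_{ji} s_{ik}) v_k +
π³ ∑_i r_{ji} w_i mod π⁴ = π³ v_j + π³ ∑ r_{ji} w_i mod π⁴`"): with `∑_i s_{ik} r_{ji} = uπ δ_{jk}`
the linear part of the substituted relation `f_j`, `j ≤ c`, is `π³ (u v_j + ∑_i r_{ji} w_i)`.
[cite: StacksProject, Tag 07CR] -/
theorem linear_part_eq (Jr : Matrix (Fin n) (Fin c) R) (u : R)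
    (hBm : Bm * Jr = (u * π) • (1 : Matrix (Fin c) (Fin c) R)) (j' : Fin c) :
    ∑ i, C (Jr i j') * δx π Bm i =
      C (π ^ 3) * (C u * X (Sum.inl j') + ∑ i, C (Jr i j') * X (Sum.inr i)) := by
  have hk : ∀ k, ∑ i, Bm k i * Jr i j' = if k = j' then u * π else 0 := fun k => by
    have := congrFun (congrFun hBm k) j'
    rwa [Matrix.mul_apply, Matrix.smul_apply, Matrix.one_apply, smul_eq_mul, mul_ite, mul_one,
      mul_zero] at this
  have hA : ∀ k, ∑ i, C (Jr i j') * (C (π ^ 2 * Bm k i) * X (Sum.inl k)) =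
      C (π ^ 2 * ∑ i, Bm k i * Jr i j') * (X (Sum.inl k) : MvPolynomial (V c n) R) := fun k => by
    rw [Finset.mul_sum, map_sum, Finset.sum_mul]
    refine Finset.sum_congr rfl fun i _ => ?_
    rw [← mul_assoc, ← map_mul, show Jr i j' * (π ^ 2 * Bm k i) = π ^ 2 * (Bm k i * Jr i j') by ring]
  have hB : ∀ i, C (Jr i j') * (C (π ^ 3) * X (Sum.inr i)) =
      C (π ^ 3) * (C (Jr i j') * (X (Sum.inr i) : MvPolynomial (V c n) R)) := fun i => by
    rw [← mul_assoc, ← mul_assoc, mul_comm (C (Jr i j'))]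
  calc ∑ i, C (Jr i j') * δx π Bm i
      = ∑ i, (∑ k, C (Jr i j') * (C (π ^ 2 * Bm k i) * X (Sum.inl k)) +
          C (Jr i j') * (C (π ^ 3) * X (Sum.inr i))) := by
        refine Finset.sum_congr rfl fun i _ => ?_
        rw [δx_eq, mul_add, Finset.mul_sum]
    _ = ∑ k, C (π ^ 2 * ∑ i, Bm k i * Jr i j') * X (Sum.inl k) +
          C (π ^ 3) * ∑ i, C (Jr i j') * X (Sum.inr i) := by
        rw [Finset.sum_add_distrib, Finset.sum_comm]
        simp_rw [hA, hB, ← Finset.mul_sum]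
    _ = C (π ^ 3) * (C u * X (Sum.inl j') + ∑ i, C (Jr i j') * X (Sum.inr i)) := by
        simp_rw [hk, mul_ite, mul_zero, apply_ite C, map_zero, ite_mul, zero_mul,
          Finset.sum_ite_eq', Finset.mem_univ, if_true]
        rw [mul_add, ← mul_assoc (C (π ^ 3)), ← map_mul,
          show π ^ 2 * (u * π) = π ^ 3 * u by ring]

/-- The error term `q` of `exists_subst_eq` (a choice). [cite: StacksProject, Tag 07CR] -/
def qPoly (f : MvPolynomial (Fin n) R) : MvPolynomial (V c n) R :=
  Classical.choose (exists_subst_eq π r Bm f)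

/-- Defining property of `qPoly`. [cite: StacksProject, Tag 07CR] -/
theorem qPoly_spec (f : MvPolynomial (Fin n) R) :
    subst π r Bm f = C (aeval r f) + ∑ i, C (aeval r (pderiv i f)) * δx π Bm i +
      C (π ^ 4) * qPoly π r Bm f :=
  Classical.choose_spec (exists_subst_eq π r Bm f)

/-- Stacks' `g_j ∈ R[v, w]` with `f_j(x(v, w)) = π³ g_j` and `g_j ≡ v_j + ∑_i r_{ji} w_i mod π`:
explicitly `g_j = π t_j + u v_j + ∑_i r_{ji} w_i + π q_j` where `f_j(r) = π⁴ t_j` and `π⁴ q_j` is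
the image of the higher order terms. [cite: StacksProject, Tag 07CR] -/
def gPoly (Jr : Matrix (Fin n) (Fin c) R) (u t : R) (j' : Fin c) (f : MvPolynomial (Fin n) R) :
    MvPolynomial (V c n) R :=
  C (π * t) + C u * X (Sum.inl j') + ∑ i, C (Jr i j') * X (Sum.inr i) + C π * qPoly π r Bm f

variable (Jr : Matrix (Fin n) (Fin c) R) (u : R)

/-- `π³ g_j = f_j(x(v, w))` (Stacks 07CR: "such that `f_j = π³ g_j` in the `R`-algebra
`R[x, v, w]/(h)`"). [cite: StacksProject, Tag 07CR] -/
theorem C_mul_gPoly {t : R} {j' : Fin c} {f : MvPolynomial (Fin n) R}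
    (hf : aeval r f = π ^ 4 * t) (hJr : ∀ i, aeval r (pderiv i f) = Jr i j')
    (hBm : Bm * Jr = (u * π) • (1 : Matrix (Fin c) (Fin c) R)) :
    C (π ^ 3) * gPoly π r Bm Jr u t j' f = subst π r Bm f := by
  rw [qPoly_spec, hf, gPoly]
  simp_rw [hJr]
  rw [linear_part_eq π Bm Jr u hBm j']
  simp only [mul_add, ← mul_assoc, ← map_mul]
  rw [show π ^ 3 * π * t = π ^ 4 * t by ring, show π ^ 3 * π = π ^ 4 by ring]
  abel

/-- `g_j ≡ v_j + ∑_i r_{ji} w_i mod π` (as `u ≡ 1 mod π³`). [cite: StacksProject, Tag 07CR] -/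
theorem gPoly_sub_mem {t t₀ : R} (hu : u = 1 - π ^ 3 * t₀) (j' : Fin c)
    (f : MvPolynomial (Fin n) R) :
    gPoly π r Bm Jr u t j' f - (X (Sum.inl j') + ∑ i, C (Jr i j') * X (Sum.inr i)) ∈
      Ideal.span {(C π : MvPolynomial (V c n) R)} := by
  refine Ideal.mem_span_singleton'.mpr ⟨C t - C π ^ 2 * C t₀ * X (Sum.inl j') + qPoly π r Bm f, ?_⟩
  rw [gPoly, hu]
  simp only [map_sub, map_one, map_mul, map_pow]
  ring

/-- For the remaining relations (`j > c`): `f_j(x(v, w))` is divisible by `π²` (Stacks 07CR: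
"the image of `f_{c+j}` in `(B')_{𝔮'}` is divisible by `π²`"). [cite: StacksProject, Tag 07CR] -/
theorem exists_subst_eq_C_sq_mul {t : R} {f : MvPolynomial (Fin n) R} (hf : aeval r f = π ^ 4 * t) :
    ∃ y : MvPolynomial (V c n) R, subst π r Bm f = C (π ^ 2) * y := by
  refine ⟨C (π ^ 2 * t) + ∑ i, C (aeval r (pderiv i f)) * eV π Bm i + C (π ^ 2) * qPoly π r Bm f, ?_⟩
  have h1 : C (π ^ 2) * C (π ^ 2 * t) = (C (π ^ 4 * t) : MvPolynomial (V c n) R) := by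
    rw [← map_mul]; congr 1; ring
  have h2 : C (π ^ 2) * (C (π ^ 2) * qPoly π r Bm f) = C (π ^ 4) * qPoly π r Bm f := by
    rw [← mul_assoc, ← map_mul]; congr 2; ring
  have h3 : ∀ i, C (π ^ 2) * (C (aeval r (pderiv i f)) * eV π Bm i) =
      C (aeval r (pderiv i f)) * δx π Bm i := fun i => by rw [δx, mul_left_comm]
  rw [qPoly_spec, hf, mul_add, mul_add, Finset.mul_sum, h1, h2]
  simp_rw [h3]

end Subst

/-! ## ST4. The algebra `B = R[v, w]/(g_1, …, g_c, f̃_{c+1}, …, f̃_m)` and the maps `A → B → Λ` -/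

section Algebras

variable {R : Type u} [CommRing R] {A : Type u} [CommRing A] [Algebra R A] {n m c : ℕ}
  (P : Algebra.Presentation R A (Fin n) (Fin m)) (hcm : c ≤ m)
  (π : R) (r : Fin n → R) (Bm : Matrix (Fin c) (Fin n) R) (u : R) (t : Fin m → R)

/-- The matrix `r_{ji} = (∂f_j/∂x_i)(r)`, `j ≤ c` (Stacks: "the constant term of `∂f_j/∂x_i` is
`r_{ji}`", after the translation `x ↦ x + r`). [cite: StacksProject, Tag 07CR] -/
def Jr : Matrix (Fin n) (Fin c) R :=
  Matrix.of fun i j' => aeval r (pderiv i (P.relation (Fin.castLE hcm j')))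

/-- The relations of `B`: `g_j` for `j ≤ c` and `f̃_j = f_j(x(v, w))` for `j > c`.
[cite: StacksProject, Tag 07CR] -/
def relB (j : Fin m) : MvPolynomial (V c n) R :=
  if h : (j : ℕ) < c then gPoly π r Bm (Jr P hcm r) u (t j) ⟨j, h⟩ (P.relation j)
  else subst π r Bm (P.relation j)

/-- The ideal of relations of `B`. [cite: StacksProject, Tag 07CR] -/
abbrev idealB : Ideal (MvPolynomial (V c n) R) := Ideal.span (Set.range (relB P hcm π r Bm u t))

/-- **The algebra `B`** of Stacks 07CR (with the variables `x_i` eliminated using `h_i`):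
`B = R[v_1, …, v_c, w_1, …, w_n]/(g_1, …, g_c, f̃_{c+1}, …, f̃_m)`. [cite: StacksProject, Tag 07CR] -/
abbrev Balg : Type u := MvPolynomial (V c n) R ⧸ idealB P hcm π r Bm u t

/-- `B` is of finite presentation over `R`. [cite: StacksProject, Tag 07CR] -/
instance : Algebra.FinitePresentation R (Balg P hcm π r Bm u t) :=
  Algebra.FinitePresentation.quotient (Submodule.fg_span (Set.finite_range _))

variable (ht : ∀ j, aeval r (P.relation j) = π ^ 4 * t j)
  (hBm : Bm * Jr P hcm r = (u * π) • (1 : Matrix (Fin c) (Fin c) R))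

include ht hBm in
/-- `π³ g_j = f_j(x(v, w))` for `j ≤ c`. [cite: StacksProject, Tag 07CR] -/
theorem C_mul_relB_of_lt (j : Fin m) (h : (j : ℕ) < c) :
    C (π ^ 3) * relB P hcm π r Bm u t j = subst π r Bm (P.relation j) := by
  rw [relB, dif_pos h]
  refine C_mul_gPoly π r Bm (Jr P hcm r) u (ht j) (fun i => ?_) hBm
  simp [Jr, Fin.castLE]

/-- The relations `f̃_j` for `j > c`. [cite: StacksProject, Tag 07CR] -/
theorem relB_of_not_lt (j : Fin m) (h : ¬ (j : ℕ) < c) :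
    relB P hcm π r Bm u t j = subst π r Bm (P.relation j) := by
  rw [relB, dif_neg h]

include ht hBm in
/-- `f_j(x(v, w)) ∈ (g_1, …, g_c, f̃_{c+1}, …, f̃_m)` for all `j`. [cite: StacksProject, Tag 07CR] -/
theorem subst_relation_mem_idealB (j : Fin m) :
    subst π r Bm (P.relation j) ∈ idealB P hcm π r Bm u t := by
  by_cases h : (j : ℕ) < c
  · rw [← C_mul_relB_of_lt P hcm π r Bm u t ht hBm j h]
    exact Ideal.mul_mem_left _ _ (Ideal.subset_span ⟨j, rfl⟩)
  · rw [← relB_of_not_lt P hcm π r Bm u t j h]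
    exact Ideal.subset_span ⟨j, rfl⟩

include ht hBm in
/-- The relations of `A` die in `B`. [cite: StacksProject, Tag 07CR] -/
theorem ker_le_comap_idealB :
    P.ker ≤ Ideal.comap (subst π r Bm : MvPolynomial (Fin n) R →ₐ[R] MvPolynomial (V c n) R)
      (idealB P hcm π r Bm u t) := by
  rw [← P.span_range_relation_eq_ker, Ideal.span_le]
  rintro _ ⟨j, rfl⟩
  exact subst_relation_mem_idealB P hcm π r Bm u t ht hBm j

/-- **The map `A → B`**, `x_i ↦ r_i + π² ∑_k s_{ik} v_k + π³ w_i`. [cite: StacksProject, Tag 07CR] -/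
def toB : A →ₐ[R] Balg P hcm π r Bm u t :=
  (Ideal.Quotient.liftₐ P.ker
    ((Ideal.Quotient.mkₐ R (idealB P hcm π r Bm u t)).comp (subst π r Bm)) fun a ha => by
      rw [AlgHom.comp_apply, Ideal.Quotient.mkₐ_eq_mk, Ideal.Quotient.eq_zero_iff_mem]
      exact ker_le_comap_idealB P hcm π r Bm u t ht hBm ha).comp
    (P.quotientEquiv.restrictScalars R).symm.toAlgHom

/-- Formula for `A → B` on polynomials in the generators. [cite: StacksProject, Tag 07CR] -/
theorem toB_aeval (p : MvPolynomial (Fin n) R) :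
    toB P hcm π r Bm u t ht hBm (aeval P.val p) =
      Ideal.Quotient.mk (idealB P hcm π r Bm u t) (subst π r Bm p) := by
  have h1 : (P.quotientEquiv.restrictScalars R).symm (aeval P.val p) = Ideal.Quotient.mk P.ker p := by
    apply (P.quotientEquiv.restrictScalars R).injective
    rw [AlgEquiv.apply_symm_apply, AlgEquiv.restrictScalars_apply, Algebra.Presentation.quotientEquiv_mk,
      P.algebraMap_apply]
  unfold toB
  rw [AlgHom.comp_apply]
  change Ideal.Quotient.liftₐ P.ker ((Ideal.Quotient.mkₐ R (idealB P hcm π r Bm u t)).comp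
    (subst π r Bm)) _ ((P.quotientEquiv.restrictScalars R).symm (aeval P.val p)) = _
  rw [h1]
  rfl

/-! ### The map `B → Λ` -/

variable {Λ : Type u} [CommRing Λ] [Algebra R Λ] (φ : A →ₐ[R] Λ) (lam : Fin n → Λ)

/-- Evaluation `R[v, w] → Λ`, `v_j ↦ 0`, `w_i ↦ π λ_i`. [cite: StacksProject, Tag 07CR] -/
abbrev evΛ : MvPolynomial (V c n) R →ₐ[R] Λ :=
  aeval (Sum.elim (0 : Fin c → Λ) fun i => algebraMap R Λ π * lam i)

variable (hlam : ∀ i, φ (P.val i) = algebraMap R Λ (r i) + algebraMap R Λ π ^ 4 * lam i)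

include hlam in
/-- Under `v ↦ 0`, `w ↦ πλ` the substitution `x(v, w)` goes to `φ(x)` (as `φ(x_i) = r_i + π⁴λ_i`).
[cite: StacksProject, Tag 07CR] -/
theorem evΛ_subst (p : MvPolynomial (Fin n) R) :
    evΛ π lam (subst π r Bm p) = φ (aeval P.val p) := by
  have h : (evΛ π lam).comp (subst π r Bm : MvPolynomial (Fin n) R →ₐ[R] MvPolynomial (V c n) R) =
      φ.comp (aeval P.val) := by
    refine MvPolynomial.algHom_ext fun i => ?_
    rw [AlgHom.comp_apply, AlgHom.comp_apply, aeval_X, aeval_X, hlam, map_add, aeval_C, δx_eq,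
      map_add, map_sum, map_mul, aeval_C, aeval_X, Sum.elim_inr]
    simp only [map_mul, aeval_C, aeval_X, Sum.elim_inl, Pi.zero_apply, mul_zero,
      Finset.sum_const_zero, zero_add, map_pow]
    ring
  exact AlgHom.congr_fun h p

variable (hΛ : ∀ x : Λ, algebraMap R Λ π ^ 2 * x = 0 → algebraMap R Λ π * x = 0)
  {t₀ : R} (hu : u = 1 - π ^ 3 * t₀)

include hΛ in
/-- `Ann_Λ(π) = Ann_Λ(π²)` implies `Ann_Λ(π) = Ann_Λ(π⁴)`. [folklore] -/
theorem pi_mul_eq_zero_of_pow_four (x : Λ) (h : algebraMap R Λ π ^ 4 * x = 0) :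
    algebraMap R Λ π * x = 0 := by
  have h1 : algebraMap R Λ π * (algebraMap R Λ π ^ 2 * x) = 0 :=
    hΛ (algebraMap R Λ π ^ 2 * x) (by rw [← h]; ring)
  have h2 : algebraMap R Λ π * (algebraMap R Λ π * x) = 0 :=
    hΛ (algebraMap R Λ π * x) (by rw [← h1]; ring)
  exact hΛ x (by rw [← h2]; ring)

include ht hBm hlam hΛ hu in
/-- The relations of `B` die in `Λ`: for `j > c` because `f_j(φ(x)) = 0`; for `j ≤ c` the image
`t` of `g_j` satisfies `π³ t = 0` and `t ∈ πΛ`, hence `t = 0` as `Ann_Λ(π) = Ann_Λ(π²)` (Stacks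
07CR: "Hence our assumption that `Ann_Λ(π) = Ann_Λ(π²)` implies that `t = 0`").
[cite: StacksProject, Tag 07CR] -/
theorem evΛ_relB (j : Fin m) : evΛ π lam (relB P hcm π r Bm u t j) = 0 := by
  by_cases h : (j : ℕ) < c
  · -- `π³ · ev(g_j) = ev(f̃_j) = 0`
    have h3 : algebraMap R Λ π ^ 3 * evΛ π lam (relB P hcm π r Bm u t j) = 0 := by
      have := congrArg (evΛ π lam) (C_mul_relB_of_lt P hcm π r Bm u t ht hBm j h)
      rwa [map_mul, aeval_C, map_pow, evΛ_subst P π r Bm φ lam hlam, P.aeval_val_relation,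
        map_zero] at this
    -- `ev(g_j) ∈ πΛ`
    have hrel : relB P hcm π r Bm u t j =
        gPoly π r Bm (Jr P hcm r) u (t j) ⟨j, h⟩ (P.relation j) := by rw [relB, dif_pos h]
    obtain ⟨d, hd⟩ := Ideal.mem_span_singleton'.mp
      (gPoly_sub_mem π r Bm (Jr P hcm r) u (t := t j) hu ⟨j, h⟩ (P.relation j))
    have hg := sub_eq_iff_eq_add.mp hd.symm
    have hsum : ∑ i, algebraMap R Λ (Jr P hcm r i ⟨j, h⟩) * (algebraMap R Λ π * lam i) =
        algebraMap R Λ π * ∑ i, algebraMap R Λ (Jr P hcm r i ⟨j, h⟩) * lam i := by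
      rw [Finset.mul_sum]
      exact Finset.sum_congr rfl fun i _ => by ring
    have hev : evΛ π lam (relB P hcm π r Bm u t j) = algebraMap R Λ π *
        (evΛ π lam d + ∑ i, algebraMap R Λ (Jr P hcm r i ⟨j, h⟩) * lam i) := by
      rw [hrel, hg]
      simp only [map_add, map_mul, aeval_C, aeval_X, Sum.elim_inl, Sum.elim_inr, Pi.zero_apply,
        zero_add, map_sum]
      rw [hsum, mul_add, mul_comm (evΛ π lam d)]
    rw [hev] at h3 ⊢
    apply pi_mul_eq_zero_of_pow_four π hΛ
    rw [← h3]
    ring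
  · rw [relB_of_not_lt P hcm π r Bm u t j h, evΛ_subst P π r Bm φ lam hlam, P.aeval_val_relation,
      map_zero]

/-- **The map `B → Λ`**, `v_j ↦ 0`, `w_i ↦ π λ_i`. [cite: StacksProject, Tag 07CR] -/
def toΛ : Balg P hcm π r Bm u t →ₐ[R] Λ :=
  Ideal.Quotient.liftₐ (idealB P hcm π r Bm u t) (evΛ π lam) fun a ha => by
    rw [← RingHom.mem_ker]
    refine (Ideal.span_le.mpr ?_) ha
    rintro _ ⟨j, rfl⟩
    exact evΛ_relB P hcm π r Bm u t ht hBm φ lam hlam hΛ hu j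

/-- Formula for `B → Λ`. [cite: StacksProject, Tag 07CR] -/
theorem toΛ_mk (p : MvPolynomial (V c n) R) :
    toΛ P hcm π r Bm u t ht hBm φ lam hlam hΛ hu (Ideal.Quotient.mk _ p) = evΛ π lam p := rfl

include hlam in
/-- `A → B → Λ` is the given map `φ`. [cite: StacksProject, Tag 07CR] -/
theorem toΛ_toB (a : A) :
    toΛ P hcm π r Bm u t ht hBm φ lam hlam hΛ hu (toB P hcm π r Bm u t ht hBm a) = φ a := by
  obtain ⟨p, rfl⟩ := P.algebraMap_surjective a
  rw [P.algebraMap_apply, toB_aeval, toΛ_mk, evΛ_subst P π r Bm φ lam hlam]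

/-! ## ST5. `B_π ≅ A_π[v_1, …, v_c]` is formally smooth -/

section AwayPi

omit [Algebra R Λ] in
/-- In an algebra where `π` is invertible, `π³ y = 0` forces `y = 0`. [folklore] -/
theorem eq_zero_of_C_pow_mul_eq_zero {T : Type u} [CommRing T] [Algebra R T]
    (hπ : IsUnit (algebraMap R T π)) {y : T} (h : algebraMap R T (π ^ 3) * y = 0) : y = 0 := by
  rw [map_pow] at h
  exact (hπ.pow 3).mul_right_eq_zero.mp h

/-- The localization `A_π`. [folklore] -/
abbrev Aπ (A : Type u) [CommRing A] [Algebra R A] (π : R) : Type u :=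
  Localization.Away (algebraMap R A π)

/-- `w_i ↦ π⁻³ (x_i - r_i - π² ∑_k s_{ik} v_k)` in `A_π[v]`. [cite: StacksProject, Tag 07CR] -/
def wT (i : Fin n) : MvPolynomial (Fin c) (Aπ A π) :=
  C (((IsLocalization.Away.algebraMap_isUnit (algebraMap R A π)).unit⁻¹ : (Aπ A π)ˣ) ^ 3 : Aπ A π) *
    (C (algebraMap A (Aπ A π) (P.val i)) - C (algebraMap R (Aπ A π) (r i)) -
      ∑ k, C (algebraMap R (Aπ A π) (π ^ 2 * Bm k i)) * X k)

/-- `R[v, w] → A_π[v]`. [cite: StacksProject, Tag 07CR] -/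
abbrev ξpoly : MvPolynomial (V c n) R →ₐ[R] MvPolynomial (Fin c) (Aπ A π) :=
  aeval (Sum.elim X (wT P π r Bm))

/-- `π³ · π⁻³ = 1` in `A_π`. [folklore] -/
theorem algebraMap_Aπ_pi_pow_three_mul_unit :
    algebraMap R (Aπ A π) (π ^ 3) *
      (((IsLocalization.Away.algebraMap_isUnit (algebraMap R A π)).unit⁻¹ : (Aπ A π)ˣ) ^ 3 : Aπ A π)
      = 1 := by
  set U := (IsLocalization.Away.algebraMap_isUnit (S := Aπ A π) (algebraMap R A π)).unit
    with hUdef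
  have hU : algebraMap R (Aπ A π) π = (U : Aπ A π) := by
    rw [hUdef, IsUnit.unit_spec, IsScalarTower.algebraMap_apply R A (Aπ A π)]
  rw [map_pow, hU, ← Units.val_pow_eq_pow_val, ← Units.val_pow_eq_pow_val, ← Units.val_mul,
    ← mul_pow, mul_inv_cancel, one_pow, Units.val_one]

/-- The substitution followed by `R[v, w] → A_π[v]` is `x ↦ x` (Stacks 07CR: `B_π ≅ A_π[v]`
"because the equations `g_i = 0` are implied by `f_i = 0`"). [cite: StacksProject, Tag 07CR] -/
theorem ξpoly_subst (p : MvPolynomial (Fin n) R) :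
    ξpoly P π r Bm (subst π r Bm p) = C (algebraMap A (Aπ A π) (aeval P.val p)) := by
  have h : (ξpoly P π r Bm).comp (subst π r Bm : MvPolynomial (Fin n) R →ₐ[R] _) =
      ((IsScalarTower.toAlgHom R (Aπ A π) (MvPolynomial (Fin c) (Aπ A π))).comp
        (IsScalarTower.toAlgHom R A (Aπ A π))).comp (aeval P.val) := by
    refine MvPolynomial.algHom_ext fun i => ?_
    rw [AlgHom.comp_apply, AlgHom.comp_apply, AlgHom.comp_apply, aeval_X, aeval_X,
      IsScalarTower.coe_toAlgHom', IsScalarTower.coe_toAlgHom', MvPolynomial.algebraMap_eq]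
    rw [map_add, aeval_C, MvPolynomial.algebraMap_apply, δx_eq, map_add, map_sum, map_mul, aeval_C,
      MvPolynomial.algebraMap_apply, aeval_X, Sum.elim_inr]
    have hw : C (algebraMap R (Aπ A π) (π ^ 3)) * wT P π r Bm i =
        C (algebraMap A (Aπ A π) (P.val i)) - C (algebraMap R (Aπ A π) (r i)) -
          ∑ k, C (algebraMap R (Aπ A π) (π ^ 2 * Bm k i)) * X k := by
      rw [wT, ← mul_assoc, ← map_mul, algebraMap_Aπ_pi_pow_three_mul_unit, map_one, one_mul]
    have hs : ∑ k, ξpoly P π r Bm (C (π ^ 2 * Bm k i) * X (Sum.inl k)) =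
        ∑ k, C (algebraMap R (Aπ A π) (π ^ 2 * Bm k i)) * (X k : MvPolynomial (Fin c) (Aπ A π)) :=
      Finset.sum_congr rfl fun k _ => by
        rw [map_mul, aeval_C, MvPolynomial.algebraMap_apply, aeval_X, Sum.elim_inl]
    rw [hw, hs]
    abel
  exact AlgHom.congr_fun h p

variable (ht : ∀ j, aeval r (P.relation j) = π ^ 4 * t j)
  (hBm : Bm * Jr P hcm r = (u * π) • (1 : Matrix (Fin c) (Fin c) R))

include ht hBm in
/-- The relations of `B` die in `A_π[v]`. [cite: StacksProject, Tag 07CR] -/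
theorem ξpoly_relB (j : Fin m) : ξpoly P π r Bm (relB P hcm π r Bm u t j) = 0 := by
  by_cases h : (j : ℕ) < c
  · have := congrArg (ξpoly P π r Bm) (C_mul_relB_of_lt P hcm π r Bm u t ht hBm j h)
    rw [map_mul, aeval_C, ξpoly_subst, P.aeval_val_relation, map_zero, map_zero] at this
    refine eq_zero_of_C_pow_mul_eq_zero π ?_ this
    rw [MvPolynomial.algebraMap_apply, IsScalarTower.algebraMap_apply R A (Aπ A π)]
    exact (IsLocalization.Away.algebraMap_isUnit (S := Aπ A π) (algebraMap R A π)).map C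
  · rw [relB_of_not_lt P hcm π r Bm u t j h, ξpoly_subst, P.aeval_val_relation, map_zero, map_zero]

/-- `B → A_π[v]`. [cite: StacksProject, Tag 07CR] -/
def ξB : Balg P hcm π r Bm u t →ₐ[R] MvPolynomial (Fin c) (Aπ A π) :=
  Ideal.Quotient.liftₐ (idealB P hcm π r Bm u t) (ξpoly P π r Bm) fun a ha => by
    rw [← RingHom.mem_ker]
    refine (Ideal.span_le.mpr ?_) ha
    rintro _ ⟨j, rfl⟩
    exact ξpoly_relB P hcm π r Bm u t ht hBm j

/-- The localization `B_π`. [folklore] -/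
abbrev Bπ : Type u := Localization.Away (algebraMap R (Balg P hcm π r Bm u t) π)

/-- `π` becomes a unit in `A_π[v]`. [folklore] -/
theorem isUnit_ξB : ∀ y : Submonoid.powers (algebraMap R (Balg P hcm π r Bm u t) π),
    IsUnit (ξB P hcm π r Bm u t ht hBm y) := by
  rintro ⟨_, k, rfl⟩
  rw [map_pow, AlgHom.commutes, MvPolynomial.algebraMap_apply,
    IsScalarTower.algebraMap_apply R A (Aπ A π)]
  exact ((IsLocalization.Away.algebraMap_isUnit (S := Aπ A π) (algebraMap R A π)).map C).pow k

/-- `Ξ : B_π → A_π[v]`. [cite: StacksProject, Tag 07CR] -/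
def ΞBπ : Bπ P hcm π r Bm u t →ₐ[R] MvPolynomial (Fin c) (Aπ A π) :=
  IsLocalization.liftAlgHom (M := Submonoid.powers (algebraMap R (Balg P hcm π r Bm u t) π))
    (f := ξB P hcm π r Bm u t ht hBm) (isUnit_ξB P hcm π r Bm u t ht hBm)

/-- `π` becomes a unit in `B_π`. [folklore] -/
theorem isUnit_toB : ∀ y : Submonoid.powers (algebraMap R A π),
    IsUnit (((IsScalarTower.toAlgHom R (Balg P hcm π r Bm u t) (Bπ P hcm π r Bm u t)).comp
      (toB P hcm π r Bm u t ht hBm)) y) := by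
  rintro ⟨_, k, rfl⟩
  rw [map_pow, AlgHom.commutes]
  exact (IsLocalization.Away.algebraMap_isUnit (S := Bπ P hcm π r Bm u t)
    (algebraMap R (Balg P hcm π r Bm u t) π)).pow k

/-- `A_π → B_π`. [cite: StacksProject, Tag 07CR] -/
def θAπ : Aπ A π →ₐ[R] Bπ P hcm π r Bm u t :=
  IsLocalization.liftAlgHom (M := Submonoid.powers (algebraMap R A π))
    (f := (IsScalarTower.toAlgHom R _ _).comp (toB P hcm π r Bm u t ht hBm))
    (isUnit_toB P hcm π r Bm u t ht hBm)

/-- `Θ : A_π[v] → B_π`, `v_j ↦ v_j`. [cite: StacksProject, Tag 07CR] -/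
def ΘBπ : MvPolynomial (Fin c) (Aπ A π) →ₐ[R] Bπ P hcm π r Bm u t :=
  aevalTower (θAπ P hcm π r Bm u t ht hBm)
    fun j => algebraMap (Balg P hcm π r Bm u t) _ (Ideal.Quotient.mk _ (X (Sum.inl j)))

/-- `Ξ` extends `B → A_π[v]`. [folklore] -/
theorem ΞBπ_algebraMap (b : Balg P hcm π r Bm u t) :
    ΞBπ P hcm π r Bm u t ht hBm (algebraMap _ (Bπ P hcm π r Bm u t) b) =
      ξB P hcm π r Bm u t ht hBm b := by
  rw [ΞBπ, IsLocalization.liftAlgHom_apply, IsLocalization.lift_eq]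
  rfl

/-- Formula for `B → A_π[v]`. [folklore] -/
theorem ξB_mk (p : MvPolynomial (V c n) R) :
    ξB P hcm π r Bm u t ht hBm (Ideal.Quotient.mk _ p) = ξpoly P π r Bm p := rfl

/-- `A_π → B_π` extends `A → B`. [folklore] -/
theorem θAπ_algebraMap (a : A) :
    θAπ P hcm π r Bm u t ht hBm (algebraMap A (Aπ A π) a) =
      algebraMap _ (Bπ P hcm π r Bm u t) (toB P hcm π r Bm u t ht hBm a) := by
  rw [θAπ, IsLocalization.liftAlgHom_apply, IsLocalization.lift_eq]
  rfl

/-- `R → B_π` factors through the constants of `R[v, w]`. [folklore] -/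
theorem algebraMap_Balg_eq (x : R) :
    algebraMap R (Bπ P hcm π r Bm u t) x =
      algebraMap (Balg P hcm π r Bm u t) (Bπ P hcm π r Bm u t) (Ideal.Quotient.mk _ (C x)) := by
  rw [IsScalarTower.algebraMap_apply R (Balg P hcm π r Bm u t) (Bπ P hcm π r Bm u t)]
  rfl

set_option maxHeartbeats 400000 in
/-- `Θ ∘ Ξ = id` on `B_π` (so `B_π` is a retract of — in fact isomorphic to — `A_π[v]`).
[cite: StacksProject, Tag 07CR] -/
theorem ΘBπ_comp_ΞBπ :
    (ΘBπ P hcm π r Bm u t ht hBm).comp (ΞBπ P hcm π r Bm u t ht hBm) = AlgHom.id R _ := by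
  -- reduce to `B`, then to the variables
  have key : ((ΘBπ P hcm π r Bm u t ht hBm).comp (ΞBπ P hcm π r Bm u t ht hBm)).comp
      (IsScalarTower.toAlgHom R (Balg P hcm π r Bm u t) (Bπ P hcm π r Bm u t)) =
      IsScalarTower.toAlgHom R (Balg P hcm π r Bm u t) (Bπ P hcm π r Bm u t) := by
    refine Ideal.Quotient.algHom_ext R (MvPolynomial.algHom_ext fun v => ?_)
    simp only [AlgHom.comp_apply, Ideal.Quotient.mkₐ_eq_mk, IsScalarTower.coe_toAlgHom',
      ΞBπ_algebraMap, ξB_mk, aeval_X]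
    rcases v with j | i
    · rw [Sum.elim_inl, ΘBπ, aevalTower_X]
    · rw [Sum.elim_inr, wT, ΘBπ, map_mul, aevalTower_C, map_sub, map_sub, map_sum, aevalTower_C,
        aevalTower_C, θAπ_algebraMap, AlgHom.commutes]
      have htoB : algebraMap (Balg P hcm π r Bm u t) (Bπ P hcm π r Bm u t)
          (toB P hcm π r Bm u t ht hBm (P.val i)) =
          algebraMap R _ (r i) + ∑ k, algebraMap R _ (π ^ 2 * Bm k i) *
            algebraMap (Balg P hcm π r Bm u t) (Bπ P hcm π r Bm u t)
              (Ideal.Quotient.mk _ (X (Sum.inl k))) +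
            algebraMap R _ (π ^ 3) * algebraMap (Balg P hcm π r Bm u t) (Bπ P hcm π r Bm u t)
              (Ideal.Quotient.mk _ (X (Sum.inr i))) := by
        rw [show P.val i = aeval P.val (X i : MvPolynomial (Fin n) R) from (aeval_X P.val i).symm,
          toB_aeval, aeval_X, δx_eq]
        simp only [map_add, map_sum, map_mul, algebraMap_Balg_eq]
        abel
      have hsum : ∑ k, (aevalTower (θAπ P hcm π r Bm u t ht hBm) fun j =>
          algebraMap (Balg P hcm π r Bm u t) (Bπ P hcm π r Bm u t) (Ideal.Quotient.mk _ (X (Sum.inl j))))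
            (C (algebraMap R (Aπ A π) (π ^ 2 * Bm k i)) * X k) =
          ∑ k, algebraMap R _ (π ^ 2 * Bm k i) *
            algebraMap (Balg P hcm π r Bm u t) (Bπ P hcm π r Bm u t)
              (Ideal.Quotient.mk _ (X (Sum.inl k))) :=
        Finset.sum_congr rfl fun k _ => by rw [map_mul, aevalTower_C, aevalTower_X, AlgHom.commutes]
      have hunit : θAπ P hcm π r Bm u t ht hBm
          ((((IsLocalization.Away.algebraMap_isUnit (algebraMap R A π)).unit⁻¹ : (Aπ A π)ˣ)
            : Aπ A π) ^ 3) * algebraMap R (Bπ P hcm π r Bm u t) (π ^ 3) = 1 := by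
        rw [← (θAπ P hcm π r Bm u t ht hBm).commutes, ← map_mul,
          mul_comm (((((IsLocalization.Away.algebraMap_isUnit (algebraMap R A π)).unit⁻¹ :
            (Aπ A π)ˣ) : Aπ A π) ^ 3)), algebraMap_Aπ_pi_pow_three_mul_unit, map_one]
      rw [htoB, hsum]
      rw [show ∀ a b s w : Bπ P hcm π r Bm u t, a * (b + s + w - b - s) = a * w from fun a b s w => by ring,
        ← mul_assoc, hunit, one_mul]
  refine AlgHom.coe_ringHom_injective (IsLocalization.ringHom_ext
    (Submonoid.powers (algebraMap R (Balg P hcm π r Bm u t) π)) ?_)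
  have := congrArg AlgHom.toRingHom key
  exact this

include ht hBm in
/-- **Stacks 07CR, smoothness away from `π`**: "Note that `B_π ≅ A_π[v_1, …, v_c]` … Hence
`B_π` is smooth over `R` as `A_π` is smooth over `R` by the assumption that `π` is strictly standard
in `A` over `R`, see Lemma 07CA." Here: `B_π` is a retract of the formally smooth `A_π[v]`.
[cite: StacksProject, Tag 07CR] -/
theorem formallySmooth_Bπ [Algebra.FormallySmooth R (Aπ A π)] :
    Algebra.FormallySmooth R (Bπ P hcm π r Bm u t) := by
  haveI : Algebra.FormallySmooth (Aπ A π) (MvPolynomial (Fin c) (Aπ A π)) := inferInstance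
  haveI : Algebra.FormallySmooth R (MvPolynomial (Fin c) (Aπ A π)) :=
    Algebra.FormallySmooth.comp R (Aπ A π) _
  exact formallySmooth_of_retract (ΞBπ P hcm π r Bm u t ht hBm) (ΘBπ P hcm π r Bm u t ht hBm)
    (ΘBπ_comp_ΞBπ P hcm π r Bm u t ht hBm)

end AwayPi

end Algebras

end Stacks07CR

end Literature.AlgebraicGeometry.Resolution

end
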